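/-
Copyright (c) 2026 the pub-hodgecm-mathlib formalisation cell (harness21).  Prover seat hodgecm-mathlib-K2Liu-p11 (g2), Track B «K2-LIT»,
#184♮ = hLiu418 = `stmt-HodgeConjecture-24832`; organ S2 «ARCH SPAN BY K-TYPE PATHS» (LEAD F0P6-plan (g14) RULING «M-158f», BATCH #7 (a), re-scoped
BATCH #8 (2) ∕ #10 (1): «S2-B FILE 1 = (α) the group chart `κ(k₁,k₂) ∈ Stab(i1)`, (β) the `K_w`-action law on the compact picture, (γ) injectivity,
(δ) the `Stab(i1)`-type in tube letters»).  THEOREMS ONLY (no `def`, no `instance`, no notation, no named-fact hypothesis, no `sorry`); the Cayley unit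
`T₁ = (1 1; i·1 −i·1)`, `½T₁′ = ½(1 −i·1; 1 i·1)` is written INLINE in ★ `K2LiuHermitianTubeFramePMinus`'s letters (no new definition).
-/
import Summits.HodgeConjecture.HodgeConjecture.Theorems.K2LiuArchInducedTubeSection     -- ★ D∞ `IsArchSiegelSection`, `archScalarSection`
import Summits.HodgeConjecture.HodgeConjecture.Theorems.K2LiuHermitianTubeFramePMinus   -- ★ the Cayley unit `T₁`: `cayley_conj_mem_UJ`, `cayley_conj_blockDiag`, …
import Summits.HodgeConjecture.HodgeConjecture.Theorems.K2LiuHermitianTubeAction        -- ★ H1-C `U(J) = P_Δ·Stab(i1)`, `moeb_I_eq_I_iff`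
import Summits.HodgeConjecture.HodgeConjecture.Theorems.K2LiuSiegelStabBlocks           -- ★ Cayley components, `eq_of_cayley_eq`, `cayley_mem_unitaryGroup`
import HarnessLib

/-!
# Crux `HLiu418`, S2-B FILE 1: THE COMPACT CHART `κ(k₁,k₂) = T₁·diag(k₁,k₂)·½T₁′` OF `K_w = Stab(i1)`, ITS AUTOMORPHY FACTORS, THE `K_w`-ACTION LAW
# ON THE COMPACT PICTURE OF ARCH SIEGEL SECTIONS, INJECTIVITY OF THE COMPACT PICTURE, AND `Stab(i1)`-TYPES IN TUBE LETTERS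

Cell `hodgecm-mathlib`, crux item hLiu418 = `stmt-HodgeConjecture-24832` (helper lane `--supports`, count-neutral).

TUBE FRAME OF RECORD (★ D∞ `K2LiuArchInducedTubeDefs`): `U(J) = {g | gᴴ J g = J}`, `J = (0 −1; 1 0)`, base point `i·1`, `K_w = Stab(i1) = {(A B; −B A)}`
(★ `K2LiuSiegelStabBlocks`), sections `IsArchSiegelSection χ s A`.  THE CHART (σ10∕σ11 of record, ★ `K2LiuHermitianTubeFramePMinus` letters):
`κ(k₁,k₂) := T₁ · diag(k₁,k₂) · ½T₁′`, `T₁ = (1 1; i·1 −i·1)`, `T₁′ = (1 −i·1; 1 i·1)`; `κ(1,v)` IS K2E5-p16's coset section `k_v` (his ★-pending PART A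
`K2LiuU22ShilovCoordinate.cayley_diag_one_eq`; not restated here).
* §1 THE CHART: `kappa_eq` (`κ(k₁,k₂) = ½ (k₁+k₂, −i(k₁−k₂); i(k₁−k₂), k₁+k₂)`, ★ `cayley_conj_blockDiag`), `kappaFst ∕ kappaSnd` (Cayley components `k₁`, `k₂`),
  `kappa_mul`, `kappa_one`, `kappa_self` (`κ(k,k) = diag(k,k) ∈ P_Δ`), `det_kappa = det k₁ · det k₂`; for unitary `k₁, k₂`: `kappa_mem_UJ` (★ `cayley_conj_mem_UJ`),
  **`moeb_kappa`** (fixes `i1`); **`denom_kappa_I : j(κ, i1) = k₂`**, `denom_kappa_negI : j(κ, −i1) = k₁`, `num_kappa_I = i·k₂`, `num_kappa_negI = −i·k₁` (BY VALUE,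
  both signs, as LEAD asked); **`exists_kappa_eq_of_stab`** (every `u ∈ Stab(i1)` IS `κ(A+iB, A−iB)` with unitary components — the chart is ONTO) and
  `kappa_injective` (★ `eq_of_cayley_eq`);
* §2 THE `K_w`-ACTION LAW (β): for `IsArchSiegelSection χ s A` and unitary `k₁`: `apply_kappa_self_mul` (`A(diag(k,k)·g) = χ(det k)·A g`),
  **`apply_kappa_one_mul_kappa : A (κ(1,v) · κ(k₁,k₂)) = χ(det k₁) · A (κ(1, k₁ᴴ v k₂))`** — the right `K_w`-translate read on the compact picture
  `F_A(v) := A(κ(1,v))`: `F_{R(κ(k₁,k₂))A}(v) = χ(det k₁)·F_A(k₁ᴴ v k₂)` (= ref1's `((h₁,h₂)f)(u) = χ(det h₁) f(h₁⁻¹ u h₂)`), and the dictionary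
  **`apply_kappa : A (κ(k₁,k₂)) = χ(det k₁) · F_A(k₁ᴴ k₂)`**;
* §3 INJECTIVITY OF THE COMPACT PICTURE (γ, first half): **`eq_of_isArchSiegelSection_of_compactPicture_eq`** — two sections with the same law `(χ, s)` whose
  compact pictures agree on `U(l)` agree on all of `U(J)` (★ H1-C `U(J) = P_Δ·Stab(i1)` + §1 onto); the second half (every continuous `F` on `U(l)` extends)
  follows K2E5-p16's PART A multiplier law and is FILE 1b;
* §4 `Stab(i1)`-TYPES IN TUBE LETTERS (δ, for S2-F (F-K)): **`stabType_of_kappaType`** — a right `κ`-character `A (g·κ(a,b)) = det(a)^{m₁}·det(b)^{m₂}·A g`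
  (unitary `a,b`) IS the `Stab(i1)`-type `A (g·u) = det(A_u+iB_u)^{m₁}·det(A_u−iB_u)^{m₂}·A g` of ★ `K2LiuArchGaussianKType.eq_mul_det_zpow_mul_archScalarSection`'s `hK`.
References: [Shimura1997, §§5–6 (Case UT), §16.4]; [KonnoKonno2007, §3.1]; [LeeZhu1998, §5]; [Knapp1986, Ch. VI §2].
HONEST LABEL: HC_CM is proved only modulo the 7 printed citations (2 remaining named inputs: hLiu418 = stmt-HodgeConjecture-24832,
h413 = stmt-HodgeConjecture-24833) until rung 0 closes; count-neutral helper, closes no socket.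
-/

set_option autoImplicit false
set_option linter.dupNamespace false

noncomputable section

open Complex Matrix
open scoped ComplexConjugate ComplexOrder

namespace Summit.HodgeConjecture.HodgeConjecture.Cruxes.HLiu418.K2LiuArchFrameBridge

open Literature.NumberTheory.ModularForms.SiegelUpperHalfSpace (num denom moeb num_def denom_def moeb_def denom_fromBlocks num_fromBlocks)
open Summit.HodgeConjecture.HodgeConjecture.Cruxes.HLiu418.K2LiuHermitianTubeCocycle
open Summit.HodgeConjecture.HodgeConjecture.Cruxes.HLiu418.K2LiuHermitianTubeAction
open Summit.HodgeConjecture.HodgeConjecture.Cruxes.HLiu418.K2LiuHermitianTubeFramePMinus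
open Summit.HodgeConjecture.HodgeConjecture.Cruxes.HLiu418.K2LiuSiegelStabBlocks
open Summit.HodgeConjecture.HodgeConjecture.Cruxes.HLiu418.K2LiuArchInducedTubeDefs

variable {l : Type*} [Fintype l] [DecidableEq l]

/-! ## §1  The chart `κ(k₁,k₂) = T₁ · diag(k₁,k₂) · ½T₁′` -/

/-- **`κ(k₁,k₂) = ½ (k₁+k₂, −i(k₁−k₂); i(k₁−k₂), k₁+k₂)`** (★ `cayley_conj_blockDiag`). [cite: Shimura1997, §6.5] [cite: Knapp1986, Ch. VI §2] -/
theorem kappa_eq (k₁ k₂ : Matrix l l ℂ) :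
    (fromBlocks 1 1 (I • 1) (-(I • 1)) : Matrix (l ⊕ l) (l ⊕ l) ℂ) * fromBlocks k₁ 0 0 k₂ * ((2 : ℂ)⁻¹ • fromBlocks 1 (-(I • 1)) 1 (I • 1)) =
      (2 : ℂ)⁻¹ • fromBlocks (k₁ + k₂) (-(I • (k₁ - k₂))) (I • (k₁ - k₂)) (k₁ + k₂) := by
  rw [conj_cayleyInv_eq_half, cayley_conj_blockDiag]

/-- First Cayley component of `κ(k₁,k₂)`: `A + iB = k₁`. [cite: Shimura1997, §6.5] -/
theorem kappaFst (k₁ k₂ : Matrix l l ℂ) :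
    ((fromBlocks 1 1 (I • 1) (-(I • 1)) : Matrix (l ⊕ l) (l ⊕ l) ℂ) * fromBlocks k₁ 0 0 k₂ * ((2 : ℂ)⁻¹ • fromBlocks 1 (-(I • 1)) 1 (I • 1))).toBlocks₁₁ +
      I • ((fromBlocks 1 1 (I • 1) (-(I • 1)) : Matrix (l ⊕ l) (l ⊕ l) ℂ) * fromBlocks k₁ 0 0 k₂ *
        ((2 : ℂ)⁻¹ • fromBlocks 1 (-(I • 1)) 1 (I • 1))).toBlocks₁₂ = k₁ := by
  rw [kappa_eq, fromBlocks_smul, toBlocks_fromBlocks₁₁, toBlocks_fromBlocks₁₂, smul_neg, smul_smul, smul_neg, smul_smul, mul_left_comm, I_mul_I,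
    mul_neg_one, neg_smul, neg_neg, ← smul_add, add_add_sub_cancel, ← two_smul ℂ k₁, smul_smul, inv_mul_cancel₀ two_ne_zero, one_smul]

/-- Second Cayley component of `κ(k₁,k₂)`: `A − iB = k₂`. [cite: Shimura1997, §6.5] -/
theorem kappaSnd (k₁ k₂ : Matrix l l ℂ) :
    ((fromBlocks 1 1 (I • 1) (-(I • 1)) : Matrix (l ⊕ l) (l ⊕ l) ℂ) * fromBlocks k₁ 0 0 k₂ * ((2 : ℂ)⁻¹ • fromBlocks 1 (-(I • 1)) 1 (I • 1))).toBlocks₁₁ -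
      I • ((fromBlocks 1 1 (I • 1) (-(I • 1)) : Matrix (l ⊕ l) (l ⊕ l) ℂ) * fromBlocks k₁ 0 0 k₂ *
        ((2 : ℂ)⁻¹ • fromBlocks 1 (-(I • 1)) 1 (I • 1))).toBlocks₁₂ = k₂ := by
  rw [kappa_eq, fromBlocks_smul, toBlocks_fromBlocks₁₁, toBlocks_fromBlocks₁₂, smul_neg, smul_smul, smul_neg, smul_smul, mul_left_comm, I_mul_I,
    mul_neg_one, neg_smul, neg_neg]
  module

/-- `κ` is multiplicative: `κ(k₁,k₂) · κ(k₁′,k₂′) = κ(k₁k₁′, k₂k₂′)`. [cite: Shimura1997, §6.5] -/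
theorem kappa_mul (k₁ k₂ k₁' k₂' : Matrix l l ℂ) :
    (fromBlocks 1 1 (I • 1) (-(I • 1)) : Matrix (l ⊕ l) (l ⊕ l) ℂ) * fromBlocks k₁ 0 0 k₂ * ((2 : ℂ)⁻¹ • fromBlocks 1 (-(I • 1)) 1 (I • 1)) *
        ((fromBlocks 1 1 (I • 1) (-(I • 1)) : Matrix (l ⊕ l) (l ⊕ l) ℂ) * fromBlocks k₁' 0 0 k₂' * ((2 : ℂ)⁻¹ • fromBlocks 1 (-(I • 1)) 1 (I • 1))) =
      (fromBlocks 1 1 (I • 1) (-(I • 1)) : Matrix (l ⊕ l) (l ⊕ l) ℂ) * fromBlocks (k₁ * k₁') 0 0 (k₂ * k₂') *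
        ((2 : ℂ)⁻¹ • fromBlocks 1 (-(I • 1)) 1 (I • 1)) := by
  have hdiag : (fromBlocks k₁ 0 0 k₂ : Matrix (l ⊕ l) (l ⊕ l) ℂ) * fromBlocks k₁' 0 0 k₂' = fromBlocks (k₁ * k₁') 0 0 (k₂ * k₂') := by
    rw [fromBlocks_multiply]
    simp only [Matrix.mul_zero, Matrix.zero_mul, add_zero, zero_add]
  rw [← hdiag]
  simp only [Matrix.mul_assoc]
  rw [← Matrix.mul_assoc ((2 : ℂ)⁻¹ • fromBlocks 1 (-(I • 1)) 1 (I • 1)) (fromBlocks 1 1 (I • 1) (-(I • 1))), cayleyInv_mul_cayley, Matrix.one_mul]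

/-- `κ(1,1) = 1`. [cite: Shimura1997, §6.5] -/
theorem kappa_one :
    (fromBlocks 1 1 (I • 1) (-(I • 1)) : Matrix (l ⊕ l) (l ⊕ l) ℂ) * fromBlocks 1 0 0 1 * ((2 : ℂ)⁻¹ • fromBlocks 1 (-(I • 1)) 1 (I • 1)) = 1 := by
  rw [fromBlocks_one, Matrix.mul_one, cayley_mul_cayleyInv]

/-- **`κ(k,k) = diag(k,k)`** — the diagonal `U(l)` goes to the LEVI part `K_w ∩ P_Δ`. [cite: Shimura1997, §6.5] -/
theorem kappa_self (k : Matrix l l ℂ) :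
    (fromBlocks 1 1 (I • 1) (-(I • 1)) : Matrix (l ⊕ l) (l ⊕ l) ℂ) * fromBlocks k 0 0 k * ((2 : ℂ)⁻¹ • fromBlocks 1 (-(I • 1)) 1 (I • 1)) =
      fromBlocks k 0 0 k := by
  rw [kappa_eq, sub_self, smul_zero, neg_zero, fromBlocks_smul, smul_zero, ← two_smul ℂ k, smul_smul, inv_mul_cancel₀ two_ne_zero, one_smul]

/-- `det κ(k₁,k₂) = det k₁ · det k₂`. [cite: Shimura1997, §6.5] -/
theorem det_kappa (k₁ k₂ : Matrix l l ℂ) :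
    ((fromBlocks 1 1 (I • 1) (-(I • 1)) : Matrix (l ⊕ l) (l ⊕ l) ℂ) * fromBlocks k₁ 0 0 k₂ * ((2 : ℂ)⁻¹ • fromBlocks 1 (-(I • 1)) 1 (I • 1))).det =
      k₁.det * k₂.det := by
  rw [det_mul, det_mul, mul_comm (det (fromBlocks 1 1 (I • 1) (-(I • 1)))), mul_assoc, ← det_mul, cayley_mul_cayleyInv, det_one, mul_one,
    det_fromBlocks_zero₂₁]

/-- `diag(k₁,k₂)` preserves the sign form `1 ⊕ −1` when `k₁, k₂` are unitary. [cite: KonnoKonno2007, §3.1] -/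
theorem diag_mem_signForm {k₁ k₂ : Matrix l l ℂ} (h₁ : k₁ᴴ * k₁ = 1) (h₂ : k₂ᴴ * k₂ = 1) :
    (fromBlocks k₁ 0 0 k₂)ᴴ * fromBlocks (1 : Matrix l l ℂ) 0 0 (-1) * fromBlocks k₁ 0 0 k₂ = fromBlocks (1 : Matrix l l ℂ) 0 0 (-1) := by
  rw [fromBlocks_conjTranspose, fromBlocks_multiply, fromBlocks_multiply]
  simp only [conjTranspose_zero, Matrix.mul_one, Matrix.zero_mul, Matrix.mul_zero, add_zero, zero_add, Matrix.mul_neg, Matrix.neg_mul, h₁, h₂,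
    neg_zero]

/-- **`κ(k₁,k₂) ∈ U(J)`** for unitary `k₁, k₂` (★ `cayley_conj_mem_UJ`). [cite: Shimura1997, §6.5] -/
theorem kappa_mem_UJ {k₁ k₂ : Matrix l l ℂ} (h₁ : k₁ᴴ * k₁ = 1) (h₂ : k₂ᴴ * k₂ = 1) :
    ((fromBlocks 1 1 (I • 1) (-(I • 1)) : Matrix (l ⊕ l) (l ⊕ l) ℂ) * fromBlocks k₁ 0 0 k₂ * ((2 : ℂ)⁻¹ • fromBlocks 1 (-(I • 1)) 1 (I • 1)))ᴴ *
        Matrix.J l ℂ * ((fromBlocks 1 1 (I • 1) (-(I • 1)) : Matrix (l ⊕ l) (l ⊕ l) ℂ) * fromBlocks k₁ 0 0 k₂ *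
          ((2 : ℂ)⁻¹ • fromBlocks 1 (-(I • 1)) 1 (I • 1))) = Matrix.J l ℂ :=
  cayley_conj_mem_UJ (diag_mem_signForm h₁ h₂)

/-- **`κ(k₁,k₂)` FIXES THE BASE POINT `i·1`** (★ H1-C `moeb_I_eq_I_iff`: for `(A B; −B A)` the stabiliser equation is an identity). [cite: Shimura1997, §6.5] -/
theorem moeb_kappa {k₁ k₂ : Matrix l l ℂ} (h₁ : k₁ᴴ * k₁ = 1) (h₂ : k₂ᴴ * k₂ = 1) :
    moeb ((fromBlocks 1 1 (I • 1) (-(I • 1)) : Matrix (l ⊕ l) (l ⊕ l) ℂ) * fromBlocks k₁ 0 0 k₂ * ((2 : ℂ)⁻¹ • fromBlocks 1 (-(I • 1)) 1 (I • 1)))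
        (I • (1 : Matrix l l ℂ)) = I • 1 := by
  rw [moeb_I_eq_I_iff (kappa_mem_UJ h₁ h₂), kappa_eq, fromBlocks_smul, toBlocks_fromBlocks₁₁, toBlocks_fromBlocks₁₂, toBlocks_fromBlocks₂₁,
    toBlocks_fromBlocks₂₂, smul_neg]
  exact add_comm _ _

/-- **`j(κ(k₁,k₂), i1) = k₂`** — the automorphy matrix at the base point is the SECOND Cayley factor. [cite: Shimura1997, §6.5] -/
theorem denom_kappa_I (k₁ k₂ : Matrix l l ℂ) :
    denom ((fromBlocks 1 1 (I • 1) (-(I • 1)) : Matrix (l ⊕ l) (l ⊕ l) ℂ) * fromBlocks k₁ 0 0 k₂ * ((2 : ℂ)⁻¹ • fromBlocks 1 (-(I • 1)) 1 (I • 1)))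
        (I • (1 : Matrix l l ℂ)) = k₂ := by
  rw [kappa_eq, fromBlocks_smul, denom_fromBlocks, Matrix.smul_mul, Matrix.mul_smul, Matrix.mul_one]
  match_scalars <;> ring_nf <;> simp only [Complex.I_sq] <;> norm_num

/-- `j(κ(k₁,k₂), −i1) = k₁` — at the conjugate base point the FIRST factor appears. [cite: Shimura1997, §6.5] -/
theorem denom_kappa_negI (k₁ k₂ : Matrix l l ℂ) :
    denom ((fromBlocks 1 1 (I • 1) (-(I • 1)) : Matrix (l ⊕ l) (l ⊕ l) ℂ) * fromBlocks k₁ 0 0 k₂ * ((2 : ℂ)⁻¹ • fromBlocks 1 (-(I • 1)) 1 (I • 1)))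
        (-(I • (1 : Matrix l l ℂ))) = k₁ := by
  rw [kappa_eq, fromBlocks_smul, denom_fromBlocks, Matrix.smul_mul, Matrix.mul_neg, Matrix.mul_smul, Matrix.mul_one]
  match_scalars <;> ring_nf <;> simp only [Complex.I_sq] <;> norm_num

/-- `num(κ(k₁,k₂), i1) = i·k₂` (so `κ · i1 = (i k₂) k₂⁻¹ = i1`). [cite: Shimura1997, §6.5] -/
theorem num_kappa_I (k₁ k₂ : Matrix l l ℂ) :
    num ((fromBlocks 1 1 (I • 1) (-(I • 1)) : Matrix (l ⊕ l) (l ⊕ l) ℂ) * fromBlocks k₁ 0 0 k₂ * ((2 : ℂ)⁻¹ • fromBlocks 1 (-(I • 1)) 1 (I • 1)))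
        (I • (1 : Matrix l l ℂ)) = I • k₂ := by
  rw [kappa_eq, fromBlocks_smul, num_fromBlocks, Matrix.smul_mul, Matrix.mul_smul, Matrix.mul_one]
  module

/-- `num(κ(k₁,k₂), −i1) = −i·k₁`. [cite: Shimura1997, §6.5] -/
theorem num_kappa_negI (k₁ k₂ : Matrix l l ℂ) :
    num ((fromBlocks 1 1 (I • 1) (-(I • 1)) : Matrix (l ⊕ l) (l ⊕ l) ℂ) * fromBlocks k₁ 0 0 k₂ * ((2 : ℂ)⁻¹ • fromBlocks 1 (-(I • 1)) 1 (I • 1)))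
        (-(I • (1 : Matrix l l ℂ))) = -(I • k₁) := by
  rw [kappa_eq, fromBlocks_smul, num_fromBlocks, Matrix.smul_mul, Matrix.mul_neg, Matrix.mul_smul, Matrix.mul_one]
  module

/-- **THE CHART IS ONTO `Stab(i1)`**: every `u ∈ U(J)` fixing `i1` is `κ(A_u + iB_u, A_u − iB_u)`, with both components unitary
(★ `cayley_mem_unitaryGroup`, ★ `eq_of_cayley_eq`). [cite: Shimura1997, §6.5] -/
theorem exists_kappa_eq_of_stab {u : Matrix (l ⊕ l) (l ⊕ l) ℂ} (hu : uᴴ * Matrix.J l ℂ * u = Matrix.J l ℂ) (hI : moeb u (I • (1 : Matrix l l ℂ)) = I • 1) :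
    (u.toBlocks₁₁ + I • u.toBlocks₁₂)ᴴ * (u.toBlocks₁₁ + I • u.toBlocks₁₂) = 1 ∧ (u.toBlocks₁₁ - I • u.toBlocks₁₂)ᴴ * (u.toBlocks₁₁ - I • u.toBlocks₁₂) = 1 ∧
      u = (fromBlocks 1 1 (I • 1) (-(I • 1)) : Matrix (l ⊕ l) (l ⊕ l) ℂ) * fromBlocks (u.toBlocks₁₁ + I • u.toBlocks₁₂) 0 0 (u.toBlocks₁₁ - I • u.toBlocks₁₂) *
        ((2 : ℂ)⁻¹ • fromBlocks 1 (-(I • 1)) 1 (I • 1)) := by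
  obtain ⟨hc₁, hc₂⟩ := cayley_mem_unitaryGroup hu hI
  have h₁ : (u.toBlocks₁₁ + I • u.toBlocks₁₂)ᴴ * (u.toBlocks₁₁ + I • u.toBlocks₁₂) = 1 := by
    have h := Matrix.mem_unitaryGroup_iff'.1 hc₁
    rwa [star_eq_conjTranspose] at h
  have h₂ : (u.toBlocks₁₁ - I • u.toBlocks₁₂)ᴴ * (u.toBlocks₁₁ - I • u.toBlocks₁₂) = 1 := by
    have h := Matrix.mem_unitaryGroup_iff'.1 hc₂
    rwa [star_eq_conjTranspose] at h
  exact ⟨h₁, h₂, eq_of_cayley_eq hu hI (kappa_mem_UJ h₁ h₂) (moeb_kappa h₁ h₂) (kappaFst _ _).symm (kappaSnd _ _).symm⟩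

omit [Fintype l] in
/-- The chart is INJECTIVE (read off the Cayley components). [cite: Shimura1997, §6.5] -/
theorem kappa_injective [Fintype l] {k₁ k₂ k₁' k₂' : Matrix l l ℂ}
    (h : (fromBlocks 1 1 (I • 1) (-(I • 1)) : Matrix (l ⊕ l) (l ⊕ l) ℂ) * fromBlocks k₁ 0 0 k₂ * ((2 : ℂ)⁻¹ • fromBlocks 1 (-(I • 1)) 1 (I • 1)) =
      (fromBlocks 1 1 (I • 1) (-(I • 1)) : Matrix (l ⊕ l) (l ⊕ l) ℂ) * fromBlocks k₁' 0 0 k₂' * ((2 : ℂ)⁻¹ • fromBlocks 1 (-(I • 1)) 1 (I • 1))) :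
    k₁ = k₁' ∧ k₂ = k₂' := by
  constructor
  · rw [← kappaFst k₁ k₂, h, kappaFst]
  · rw [← kappaSnd k₁ k₂, h, kappaSnd]

/-! ## §2  The `K_w`-action law on the compact picture (β) -/

/-- `‖det k‖ = 1` for `kᴴ k = 1`. [folklore] -/
theorem norm_det_eq_one_of_conjTranspose_mul_self {k : Matrix l l ℂ} (hk : kᴴ * k = 1) : ‖k.det‖ = 1 := by
  have h := congrArg det hk
  rw [det_mul, det_conjTranspose, det_one, star_def, ← Complex.normSq_eq_conj_mul_self] at h
  have h' : Complex.normSq k.det = 1 := by exact_mod_cast h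
  rw [← Complex.sq_norm] at h'
  nlinarith [norm_nonneg k.det, h']

/-- **LEVI PART OF THE STABILISER**: for a section `A ∈ I_w(s, χ)` and unitary `k`, `A (diag(k,k) · g) = χ(det k) · A g` (the parabolic law at
`p = diag(k,k) = κ(k,k)`, `‖det k‖ = 1`). [cite: Shimura1997, §16.4] -/
theorem apply_leviK_mul {χ : ℂ → ℂ} {s : ℂ} {A : Matrix (l ⊕ l) (l ⊕ l) ℂ → ℂ} (hA : IsArchSiegelSection χ s A) {k : Matrix l l ℂ} (hk : kᴴ * k = 1)
    (g : Matrix (l ⊕ l) (l ⊕ l) ℂ) : A (fromBlocks k 0 0 k * g) = χ k.det * A g := by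
  have hmem : (fromBlocks k 0 0 k : Matrix (l ⊕ l) (l ⊕ l) ℂ)ᴴ * Matrix.J l ℂ * fromBlocks k 0 0 k = Matrix.J l ℂ := (levi_mem_iff k k).2 hk
  have h := hA (fromBlocks k 0 0 k) g hmem (toBlocks_fromBlocks₂₁ _ _ _ _)
  rw [toBlocks_fromBlocks₁₁, norm_det_eq_one_of_conjTranspose_mul_self hk, Complex.ofReal_one, Complex.one_cpow, mul_one] at h
  exact h

/-- **THE `K_w`-ACTION LAW ON THE COMPACT PICTURE** (β): for `A ∈ I_w(s,χ)`, unitary `k₁`, any `k₂, v`: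
`A (κ(1,v) · κ(k₁,k₂)) = χ(det k₁) · A (κ(1, k₁ᴴ v k₂))` — i.e. `F_{R(κ(k₁,k₂))A}(v) = χ(det k₁) · F_A(k₁ᴴ v k₂)` for the compact picture `F_A(v) = A(κ(1,v))`
(ref1's `((h₁,h₂)f)(u) = χ(det h₁) f(h₁⁻¹ u h₂)`; S2-K's algebraic `𝔨_ℂ`-action is its differential). [cite: LeeZhu1998, §5] [cite: Shimura1997, §16.4] -/
theorem apply_kappa_one_mul_kappa {χ : ℂ → ℂ} {s : ℂ} {A : Matrix (l ⊕ l) (l ⊕ l) ℂ → ℂ} (hA : IsArchSiegelSection χ s A) {k₁ : Matrix l l ℂ}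
    (hk₁ : k₁ᴴ * k₁ = 1) (k₂ v : Matrix l l ℂ) :
    A ((fromBlocks 1 1 (I • 1) (-(I • 1)) : Matrix (l ⊕ l) (l ⊕ l) ℂ) * fromBlocks 1 0 0 v * ((2 : ℂ)⁻¹ • fromBlocks 1 (-(I • 1)) 1 (I • 1)) *
        ((fromBlocks 1 1 (I • 1) (-(I • 1)) : Matrix (l ⊕ l) (l ⊕ l) ℂ) * fromBlocks k₁ 0 0 k₂ * ((2 : ℂ)⁻¹ • fromBlocks 1 (-(I • 1)) 1 (I • 1)))) =
      χ k₁.det * A ((fromBlocks 1 1 (I • 1) (-(I • 1)) : Matrix (l ⊕ l) (l ⊕ l) ℂ) * fromBlocks 1 0 0 (k₁ᴴ * v * k₂) *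
        ((2 : ℂ)⁻¹ • fromBlocks 1 (-(I • 1)) 1 (I • 1))) := by
  -- `κ(1,v) κ(k₁,k₂) = κ(k₁, v k₂) = κ(k₁,k₁) κ(1, k₁ᴴ v k₂) = diag(k₁,k₁) κ(1, k₁ᴴ v k₂)`
  have hk₁' : k₁ * k₁ᴴ = 1 := mul_eq_one_comm.1 hk₁
  rw [kappa_mul, Matrix.one_mul, show (fromBlocks k₁ 0 0 (v * k₂) : Matrix (l ⊕ l) (l ⊕ l) ℂ) = fromBlocks (k₁ * 1) 0 0 (k₁ * (k₁ᴴ * v * k₂)) by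
    rw [Matrix.mul_one, ← Matrix.mul_assoc, ← Matrix.mul_assoc, hk₁', Matrix.one_mul], ← kappa_mul, kappa_self, apply_leviK_mul hA hk₁]

/-- **THE DICTIONARY `A|_{K_w}(k₁,k₂) = χ(det k₁) · F_A(k₁ᴴ k₂)`** (unitary `k₁`). [cite: LeeZhu1998, §5] -/
theorem apply_kappa {χ : ℂ → ℂ} {s : ℂ} {A : Matrix (l ⊕ l) (l ⊕ l) ℂ → ℂ} (hA : IsArchSiegelSection χ s A) {k₁ : Matrix l l ℂ} (hk₁ : k₁ᴴ * k₁ = 1)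
    (k₂ : Matrix l l ℂ) :
    A ((fromBlocks 1 1 (I • 1) (-(I • 1)) : Matrix (l ⊕ l) (l ⊕ l) ℂ) * fromBlocks k₁ 0 0 k₂ * ((2 : ℂ)⁻¹ • fromBlocks 1 (-(I • 1)) 1 (I • 1))) =
      χ k₁.det * A ((fromBlocks 1 1 (I • 1) (-(I • 1)) : Matrix (l ⊕ l) (l ⊕ l) ℂ) * fromBlocks 1 0 0 (k₁ᴴ * k₂) *
        ((2 : ℂ)⁻¹ • fromBlocks 1 (-(I • 1)) 1 (I • 1))) := by
  have h := apply_kappa_one_mul_kappa hA hk₁ k₂ 1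
  rwa [kappa_one, Matrix.one_mul, Matrix.mul_one] at h

/-! ## §3  Injectivity of the compact picture (γ) -/

/-- **TWO SECTIONS WITH THE SAME LAW AND THE SAME COMPACT PICTURE AGREE ON `U(J)`**: if `A, A′ ∈ I_w(s,χ)` and `A(κ(1,v)) = A′(κ(1,v))` for every unitary `v`,
then `A g = A′ g` for every `g ∈ U(J)` (★ H1-C `U(J) = P_Δ · Stab(i1)`, §1 onto, §2 dictionary). [cite: Shimura1997, §16.4] [cite: LeeZhu1998, §5] -/
theorem eq_of_isArchSiegelSection_of_compactPicture_eq {χ : ℂ → ℂ} {s : ℂ} {A A' : Matrix (l ⊕ l) (l ⊕ l) ℂ → ℂ} (hA : IsArchSiegelSection χ s A)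
    (hA' : IsArchSiegelSection χ s A')
    (h : ∀ v : Matrix l l ℂ, vᴴ * v = 1 →
      A ((fromBlocks 1 1 (I • 1) (-(I • 1)) : Matrix (l ⊕ l) (l ⊕ l) ℂ) * fromBlocks 1 0 0 v * ((2 : ℂ)⁻¹ • fromBlocks 1 (-(I • 1)) 1 (I • 1))) =
        A' ((fromBlocks 1 1 (I • 1) (-(I • 1)) : Matrix (l ⊕ l) (l ⊕ l) ℂ) * fromBlocks 1 0 0 v * ((2 : ℂ)⁻¹ • fromBlocks 1 (-(I • 1)) 1 (I • 1))))
    {g : Matrix (l ⊕ l) (l ⊕ l) ℂ} (hg : gᴴ * Matrix.J l ℂ * g = Matrix.J l ℂ) : A g = A' g := by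
  obtain ⟨X, R, u, hX, hR, hRu, hu, huI, rfl⟩ := exists_transl_levi_mul_stabilizer hg
  -- the parabolic factor `p = u(X) m(R)`
  set p : Matrix (l ⊕ l) (l ⊕ l) ℂ := fromBlocks 1 X 0 1 * fromBlocks R 0 0 R⁻¹ with hp
  have hRinv : (R⁻¹)ᴴ = (Rᴴ)⁻¹ := conjTranspose_nonsing_inv R
  have hpU : pᴴ * Matrix.J l ℂ * p = Matrix.J l ℂ := by
    refine mul_mem_UJ ((transl_mem_iff X).2 hX) ((levi_mem_iff R R⁻¹).2 ?_)
    rw [hR, mul_nonsing_inv R hRu]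
  have hp21 : p.toBlocks₂₁ = 0 := by
    rw [hp, fromBlocks_multiply]
    simp only [Matrix.zero_mul, Matrix.one_mul, zero_add, toBlocks_fromBlocks₂₁, Matrix.mul_zero]
  -- the stabiliser factor through the chart
  obtain ⟨h₁, h₂, hu_eq⟩ := exists_kappa_eq_of_stab hu huI
  rw [hu_eq, hA p _ hpU hp21, hA' p _ hpU hp21, apply_kappa hA h₁, apply_kappa hA' h₁, h _ ?_]
  -- `(k₁ᴴ k₂)` is unitary
  rw [conjTranspose_mul, conjTranspose_conjTranspose, Matrix.mul_assoc, ← Matrix.mul_assoc _ (u.toBlocks₁₁ + I • u.toBlocks₁₂)ᴴ,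
    mul_eq_one_comm.1 h₁, Matrix.one_mul, h₂]

/-! ## §4  `Stab(i1)`-types in tube letters (δ) -/

/-- **A RIGHT `κ`-CHARACTER IS A `Stab(i1)`-TYPE IN TUBE LETTERS**: if `A (g · κ(a,b)) = det(a)^{m₁} det(b)^{m₂} · A g` for all unitary `a, b` and all `g`, then
`A (g · u) = det(A_u + iB_u)^{m₁} det(A_u − iB_u)^{m₂} · A g` for every `u ∈ U(J)` fixing `i1` — the `hK` shape of ★ `K2LiuArchGaussianKType.
eq_mul_det_zpow_mul_archScalarSection` (S2-F (F-K)). [cite: Shimura1997, §6.5] [cite: LeeZhu1998, §5] -/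
theorem stabType_of_kappaType {A : Matrix (l ⊕ l) (l ⊕ l) ℂ → ℂ} {m₁ m₂ : ℤ}
    (hA : ∀ (g : Matrix (l ⊕ l) (l ⊕ l) ℂ) (a b : Matrix l l ℂ), aᴴ * a = 1 → bᴴ * b = 1 →
      A (g * ((fromBlocks 1 1 (I • 1) (-(I • 1)) : Matrix (l ⊕ l) (l ⊕ l) ℂ) * fromBlocks a 0 0 b * ((2 : ℂ)⁻¹ • fromBlocks 1 (-(I • 1)) 1 (I • 1)))) =
        a.det ^ m₁ * b.det ^ m₂ * A g)
    (g : Matrix (l ⊕ l) (l ⊕ l) ℂ) {u : Matrix (l ⊕ l) (l ⊕ l) ℂ} (hu : uᴴ * Matrix.J l ℂ * u = Matrix.J l ℂ) (hI : moeb u (I • (1 : Matrix l l ℂ)) = I • 1) :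
    A (g * u) = (u.toBlocks₁₁ + I • u.toBlocks₁₂).det ^ m₁ * (u.toBlocks₁₁ - I • u.toBlocks₁₂).det ^ m₂ * A g := by
  obtain ⟨h₁, h₂, hu_eq⟩ := exists_kappa_eq_of_stab hu hI
  conv_lhs => rw [hu_eq]
  exact hA g _ _ h₁ h₂

/-- The same for the scalar-type-times-`det` shape with `g` on the right of the character: `A (g·κ(a,b)) = χ₁(det a)·χ₂(det b)·A g` for arbitrary functions
`χ₁, χ₂ : ℂ → ℂ` of the two determinants. [cite: Shimura1997, §6.5] -/
theorem stabType_of_kappaType' {A : Matrix (l ⊕ l) (l ⊕ l) ℂ → ℂ} (χ₁ χ₂ : ℂ → ℂ)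
    (hA : ∀ (g : Matrix (l ⊕ l) (l ⊕ l) ℂ) (a b : Matrix l l ℂ), aᴴ * a = 1 → bᴴ * b = 1 →
      A (g * ((fromBlocks 1 1 (I • 1) (-(I • 1)) : Matrix (l ⊕ l) (l ⊕ l) ℂ) * fromBlocks a 0 0 b * ((2 : ℂ)⁻¹ • fromBlocks 1 (-(I • 1)) 1 (I • 1)))) =
        χ₁ a.det * χ₂ b.det * A g)
    (g : Matrix (l ⊕ l) (l ⊕ l) ℂ) {u : Matrix (l ⊕ l) (l ⊕ l) ℂ} (hu : uᴴ * Matrix.J l ℂ * u = Matrix.J l ℂ) (hI : moeb u (I • (1 : Matrix l l ℂ)) = I • 1) :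
    A (g * u) = χ₁ (u.toBlocks₁₁ + I • u.toBlocks₁₂).det * χ₂ (u.toBlocks₁₁ - I • u.toBlocks₁₂).det * A g := by
  obtain ⟨h₁, h₂, hu_eq⟩ := exists_kappa_eq_of_stab hu hI
  conv_lhs => rw [hu_eq]
  exact hA g _ _ h₁ h₂

end Summit.HodgeConjecture.HodgeConjecture.Cruxes.HLiu418.K2LiuArchFrameBridge

end
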